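import Summits.Ventures.HSemireg.WedgeHankelBoxSiegelIdealPlanes

/-!
# Venture HSemireg — THE BOX SIEGEL IDEAL BY DOLBEAULT TYPE (counts): `boxSiegelIdeal_k = ⊕_{a+b=k} (boxSiegelIdeal_k ∩ H^b(⋀^a T_Y))`, the block
# dimensions add up, `dim H^b(⋀^a T_Y) = C(M,a)·C(M,b)` with `M = Σ_i m_i`, and the `(1,1)` block is gen 10's `SiegelBox`

HONEST FRAMING. Part of the Lean index of the computation cell `pub-hsemireg` (seat p10 gen 12, Sunday typer «UNIFORM-IN-n»).
Finite-dimensional EXTERIOR ALGEBRA over a field + binomial arithmetic ONLY: no variety, no cohomology theory, no sheaf, no Ext group, no semiregularity map;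
nothing here says that HC / HC_CM / HC_AV holds; no Literature fact is declared or used.  Custodian versions as in `WedgeHankelBoxSiegelIdeal` (1/3); the
dictionary (`plane₂ a b` ↦ `H^b(⋀^a T_Y)`) is QUOTED, never asserted.

THIS FILE (namespace `Summit.Ventures.HSemireg.Wedge.HankelBoxSiegelIdeal` continued; imports `WedgeHankelBoxSiegelIdealPlanes`):
* §20 **BIHOMOGENEITY AS A DIRECT SUM**: the degree-`k` block projectors add up to the identity on `⋀^k` (`sum_proj_eq_self`), so **`boxSiegelIdeal_eq_biSup`:
  `boxSiegelIdeal_k = Σ_{a ≤ k} (boxSiegelIdeal_k ∩ plane₂ a (k−a))`** and **`finrank_boxSiegelIdeal_eq_sum`: the block dimensions of (Planes) ADD UP to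
  `dim boxSiegelIdeal_k = C(Σ 2m_i, k) − [t^k] Π G_{m_i}`** (independent monomial supports); the `(1,1)` block: **`boxSiegelIdeal_inf_plane₂_one_one`:
  `boxSiegelIdeal_2 ∩ plane₂ 1 1 = SiegelBox`** (gen 10), the other degree-2 blocks being zero (Planes, pure types).
* §21 **THE BLOCK COUNT `card_filter_bideg`: `#{t : xcnt t = a, ycnt t = b} = C(#x-letters, a) · C(#y-letters, b)`** (choose the two halves separately) and
  **`card_xLetters` / `card_yLetters`: `#x-letters = #y-letters = Σ_i m_i`** (letters in the first / second half of their factor); hence **`finrank_plane₂_eq`: `dim plane₂ a b = C(M,a)·C(M,b)`**, `M = Σ_i m_i`, and the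
  closed form **`finrank_boxSiegelIdeal_inf_plane₂_eq`: `dim(boxSiegelIdeal_{a+b} ∩ plane₂ a b) + #{box-standard monomials of bidegree (a,b)} = C(M,a)·C(M,b)`**.
NOT typed (honest): the generating function `Σ_{a,b} #{box-standard of bidegree (a,b)} u^a v^b = Π_i Σ_j C(m_i,j) h_j(u,v)`; anything Ext-side.  Class side only.
-/

open Module

namespace Summit.Ventures.HSemireg.Wedge.HankelBoxSiegelIdeal

open Summit.Ventures.HSemireg.Wedge Summit.Ventures.HSemireg.Wedge.Kunneth Summit.Ventures.HSemireg.Wedge.MixedBox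
  Summit.Ventures.HSemireg.Wedge.HankelSiegel Summit.Ventures.HSemireg.Wedge.HankelSiegelIdeal
  Summit.Ventures.HSemireg.Wedge.HankelBox

variable (K : Type*) [Field K] {n : ℕ} (m : Fin n → ℕ)

/-! ## §20. Bihomogeneity as a direct sum -/

/-- the degree-`k` block projectors add up to the identity on a degree-`k` monomial. -/
lemma sum_proj_B {k : ℕ} (t : Finset (Gen m)) (ht : t.card = k) :
    ∑ a ∈ Finset.range (k + 1), Weil.proj (K := K) (fun s : Finset (Gen m) => xcnt m s = a ∧ ycnt m s = k - a) (B K (Gen m) t) = B K (Gen m) t := by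
  classical
  have hxy := xcnt_add_ycnt m t
  rw [Finset.sum_eq_single_of_mem (xcnt m t) (Finset.mem_range.mpr (by omega))]
  · rw [Weil.proj_B, if_pos ⟨rfl, by omega⟩]
  · intro a _ ha
    rw [Weil.proj_B, if_neg (fun h => ha h.1.symm)]

/-- **the degree-`k` block projectors add up to the identity on `⋀^k`.** -/
theorem sum_proj_eq_self {k : ℕ} {θ : HT K (Gen m)} (hθ : θ ∈ ⋀[K]^k (Gen m → K)) :
    ∑ a ∈ Finset.range (k + 1), Weil.proj (K := K) (fun s : Finset (Gen m) => xcnt m s = a ∧ ycnt m s = k - a) θ = θ := by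
  classical
  rw [exteriorPower_eq_Hom_univ_gen, Hom] at hθ
  induction hθ using Submodule.span_induction with
  | mem x hx => obtain ⟨t, ⟨-, ht⟩, rfl⟩ := hx; exact sum_proj_B K m t ht
  | zero => exact Finset.sum_eq_zero fun a _ => map_zero _
  | add x y _ _ hx hy =>
    conv_rhs => rw [← hx, ← hy]
    rw [← Finset.sum_add_distrib]
    exact Finset.sum_congr rfl fun a _ => map_add _ _ _
  | smul c x _ hx =>
    conv_rhs => rw [← hx]
    rw [Finset.smul_sum]
    exact Finset.sum_congr rfl fun a _ => map_smul _ _ _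

/-- **BIHOMOGENEITY: `boxSiegelIdeal_k = Σ_{a ≤ k} (boxSiegelIdeal_k ∩ plane₂ a (k − a))`.** -/
theorem boxSiegelIdeal_eq_biSup (k : ℕ) :
    boxSiegelIdeal K m k = ⨆ a ∈ Finset.range (k + 1), (boxSiegelIdeal K m k ⊓ plane₂ K m a (k - a)) := by
  classical
  refine le_antisymm (fun θ hθ => ?_) (iSup₂_le fun a _ => inf_le_left)
  rw [← sum_proj_eq_self K m (boxSiegelIdeal_le_exteriorPower K m k hθ)]
  exact Submodule.sum_mem _ fun a ha => Submodule.mem_iSup_of_mem a (Submodule.mem_iSup_of_mem ha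
    ⟨proj_mem_boxSiegelIdeal K m a (k - a) k hθ, Weil.proj_mem _ _⟩)

/-- **THE BLOCK DIMENSIONS ADD UP: `dim boxSiegelIdeal_k = Σ_{a ≤ k} dim(boxSiegelIdeal_k ∩ plane₂ a (k − a))`** (`= C(Σ 2m_i, k) − [t^k] Π G_{m_i}` by (2/3)). -/
theorem finrank_boxSiegelIdeal_eq_sum (k : ℕ) :
    finrank K (boxSiegelIdeal K m k) = ∑ a ∈ Finset.range (k + 1), finrank K ↥(boxSiegelIdeal K m k ⊓ plane₂ K m a (k - a)) := by
  classical
  conv_lhs => rw [boxSiegelIdeal_eq_biSup K m k]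
  exact Weil.finrank_biSup_eq_sum (Finset.range (k + 1)) (fun a => boxSiegelIdeal K m k ⊓ plane₂ K m a (k - a))
    (fun a (t : Finset (Gen m)) => xcnt m t = a ∧ ycnt m t = k - a) (fun a _ => inf_le_right) (fun a _ a' _ hne t ht ht' => hne (ht.1.symm.trans ht'.1))

/-- gen 10's product Siegel space lies in the `(1,1)` block. -/
lemma siegelBox_le_plane₂ : siegelBox K m ≤ plane₂ K m 1 1 := by
  rw [siegelBox, Submodule.span_le]
  rintro _ ⟨x, rfl⟩
  exact bsgen_mem_plane₂ K m x

/-- **THE `(1,1)` BLOCK: `boxSiegelIdeal_2 ∩ plane₂ 1 1 = SiegelBox`** (the Siegel directions of the factors are exactly the degree-2 isotropic part; the blocks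
`(2,0)` and `(0,2)` carry nothing — `boxSiegelIdeal_inf_plane₂_pure_x/_pure_y`). -/
theorem boxSiegelIdeal_inf_plane₂_one_one : boxSiegelIdeal K m 2 ⊓ plane₂ K m 1 1 = siegelBox K m := by
  rw [boxSiegelIdeal_two]
  exact inf_eq_left.mpr (siegelBox_le_plane₂ K m)

/-! ## §21. The block count: choose the `x`-letters and the `y`-letters separately -/

/-- **THE BLOCK COUNT: `#{t : xcnt t = a, ycnt t = b} = C(#x-letters, a) · C(#y-letters, b)`** (a support of bidegree `(a,b)` is an `a`-set of `x`-letters together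
with a `b`-set of `y`-letters). -/
theorem card_filter_bideg (a b : ℕ) :
    (Finset.univ.filter fun t : Finset (Gen m) => xcnt m t = a ∧ ycnt m t = b).card = (Finset.univ.filter fun g : Gen m => ((ofLex g).2 : ℕ) < m (ofLex g).1).card.choose a * (Finset.univ.filter fun g : Gen m => m (ofLex g).1 ≤ ((ofLex g).2 : ℕ)).card.choose b := by
  classical
  rw [← Finset.card_powersetCard a (Finset.univ.filter fun g : Gen m => ((ofLex g).2 : ℕ) < m (ofLex g).1),
    ← Finset.card_powersetCard b (Finset.univ.filter fun g : Gen m => m (ofLex g).1 ≤ ((ofLex g).2 : ℕ)), ← Finset.card_product]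
  -- the predicates
  set px : Gen m → Prop := fun g => ((ofLex g).2 : ℕ) < m (ofLex g).1 with hpx
  set py : Gen m → Prop := fun g => m (ofLex g).1 ≤ ((ofLex g).2 : ℕ) with hpy
  have hnot : ∀ g, py g ↔ ¬ px g := fun g => by simp only [hpx, hpy, not_lt]
  refine Finset.card_nbij' (fun t => (t.filter px, t.filter py)) (fun AB => AB.1 ∪ AB.2) (fun t ht => ?_) (fun AB hAB => ?_)
    (fun t _ => ?_) (fun AB hAB => ?_)
  · rw [Finset.mem_coe, Finset.mem_filter] at ht
    show (t.filter px, t.filter py) ∈ ((Finset.powersetCard a (Finset.univ.filter px) ×ˢ Finset.powersetCard b (Finset.univ.filter py) : Finset _) : Set _)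
    rw [Finset.mem_coe, Finset.mem_product, Finset.mem_powersetCard, Finset.mem_powersetCard]
    exact ⟨⟨Finset.filter_subset_filter _ (Finset.subset_univ t), ht.2.1⟩, ⟨Finset.filter_subset_filter _ (Finset.subset_univ t), ht.2.2⟩⟩
  · rw [Finset.mem_coe, Finset.mem_product, Finset.mem_powersetCard, Finset.mem_powersetCard] at hAB
    obtain ⟨⟨hA, hAa⟩, ⟨hB, hBb⟩⟩ := hAB
    have hAx : ∀ g ∈ AB.1, px g := fun g hg => (Finset.mem_filter.mp (hA hg)).2
    have hBy : ∀ g ∈ AB.2, py g := fun g hg => (Finset.mem_filter.mp (hB hg)).2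
    show AB.1 ∪ AB.2 ∈ ((Finset.univ.filter fun t : Finset (Gen m) => xcnt m t = a ∧ ycnt m t = b : Finset _) : Set _)
    rw [Finset.mem_coe, Finset.mem_filter]
    refine ⟨Finset.mem_univ _, ?_, ?_⟩
    · rw [xcnt, Finset.filter_union, Finset.filter_true_of_mem hAx, Finset.filter_false_of_mem (fun g hg => (hnot g).mp (hBy g hg)),
        Finset.union_empty, hAa]
    · rw [ycnt, Finset.filter_union, Finset.filter_false_of_mem (fun g hg => fun h => (hnot g).mp h (hAx g hg)), Finset.filter_true_of_mem hBy,
        Finset.empty_union, hBb]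
  · show t.filter px ∪ t.filter py = t
    rw [Finset.filter_congr (fun g _ => hnot g), Finset.filter_union_filter_not_eq]
  · rw [Finset.mem_coe, Finset.mem_product, Finset.mem_powersetCard, Finset.mem_powersetCard] at hAB
    obtain ⟨⟨hA, -⟩, ⟨hB, -⟩⟩ := hAB
    have hAx : ∀ g ∈ AB.1, px g := fun g hg => (Finset.mem_filter.mp (hA hg)).2
    have hBy : ∀ g ∈ AB.2, py g := fun g hg => (Finset.mem_filter.mp (hB hg)).2
    show ((AB.1 ∪ AB.2).filter px, (AB.1 ∪ AB.2).filter py) = AB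
    refine Prod.ext ?_ ?_
    · show (AB.1 ∪ AB.2).filter px = AB.1
      rw [Finset.filter_union, Finset.filter_true_of_mem hAx, Finset.filter_false_of_mem (fun g hg => (hnot g).mp (hBy g hg)), Finset.union_empty]
    · show (AB.1 ∪ AB.2).filter py = AB.2
      rw [Finset.filter_union, Finset.filter_false_of_mem (fun g hg => fun h => (hnot g).mp h (hAx g hg)), Finset.filter_true_of_mem hBy,
        Finset.empty_union]

/-- a filtered count over the box generators, factor by factor. -/
lemma card_filter_univ_Gen (p : (i : Fin n) → Fin (m i + m i) → Prop) [∀ i, DecidablePred (p i)] :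
    (Finset.univ.filter fun g : Gen m => p (ofLex g).1 (ofLex g).2).card = ∑ i : Fin n, (Finset.univ.filter (p i)).card := by
  classical
  rw [Finset.card_filter]
  simp_rw [Finset.card_filter]
  exact (Fintype.sum_equiv (toLex.symm : Gen m ≃ (Σ i : Fin n, Fin (m i + m i))) _
    (fun x : Σ i : Fin n, Fin (m i + m i) => if p x.1 x.2 then 1 else 0) fun g => rfl).trans
    (Fintype.sum_sigma fun x : Σ i : Fin n, Fin (m i + m i) => if p x.1 x.2 then 1 else 0)

/-- **`#x-letters = Σ_i m_i`.** -/
theorem card_xLetters : (Finset.univ.filter fun g : Gen m => ((ofLex g).2 : ℕ) < m (ofLex g).1).card = ∑ i : Fin n, m i := by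
  rw [card_filter_univ_Gen m (fun i c => (c : ℕ) < m i)]
  refine Finset.sum_congr rfl fun i _ => ?_
  rw [Finset.card_filter, Fin.sum_univ_eq_sum_range (fun c => if c < m i then 1 else 0) (m i + m i), ← Finset.card_filter,
    show (Finset.range (m i + m i)).filter (fun c => c < m i) = Finset.range (m i) by
      ext c; simp only [Finset.mem_filter, Finset.mem_range]; omega,
    Finset.card_range]

/-- **`#y-letters = Σ_i m_i`.** -/
theorem card_yLetters : (Finset.univ.filter fun g : Gen m => m (ofLex g).1 ≤ ((ofLex g).2 : ℕ)).card = ∑ i : Fin n, m i := by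
  rw [card_filter_univ_Gen m (fun i c => m i ≤ (c : ℕ))]
  refine Finset.sum_congr rfl fun i _ => ?_
  rw [Finset.card_filter, Fin.sum_univ_eq_sum_range (fun c => if m i ≤ c then 1 else 0) (m i + m i), ← Finset.card_filter,
    show (Finset.range (m i + m i)).filter (fun c => m i ≤ c) = Finset.Ico (m i) (m i + m i) by
      ext c; simp only [Finset.mem_filter, Finset.mem_range, Finset.mem_Ico]; omega,
    Nat.card_Ico]
  omega

/-- **`dim plane₂ a b = C(M, a) · C(M, b)`, `M = Σ_i m_i`** — the dimension of the box Dolbeault block `H^b(⋀^a T_Y)`. -/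
theorem finrank_plane₂_eq (a b : ℕ) : finrank K (plane₂ K m a b) = (∑ i : Fin n, m i).choose a * (∑ i : Fin n, m i).choose b := by
  rw [finrank_plane₂, card_filter_bideg, card_xLetters, card_yLetters]

/-- **THE DIMENSION IDENTITY BY DOLBEAULT TYPE, CLOSED FORM: `dim(boxSiegelIdeal_{a+b} ∩ plane₂ a b) + #{box-standard monomials of bidegree (a,b)} = C(M,a)·C(M,b)`.** -/
theorem finrank_boxSiegelIdeal_inf_plane₂_eq (a b : ℕ) :
    finrank K ↥(boxSiegelIdeal K m (a + b) ⊓ plane₂ K m a b) + Fintype.card {f : BIdx m n (a + b) // xdeg m f.1 = a ∧ ydeg m f.1 = b} =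
      (∑ i : Fin n, m i).choose a * (∑ i : Fin n, m i).choose b := by
  rw [finrank_boxSiegelIdeal_inf_plane₂, card_filter_bideg, card_xLetters, card_yLetters]

/-- consistency in the `(1,1)` block: `#{box-standard monomials of bidegree (1,1)} + dim SiegelBox = M²` (with gen 10's `2·dim SiegelBox = Σ m_i(m_i+1)`). -/
theorem card_stdmon_one_one_add :
    Fintype.card {f : BIdx m n (1 + 1) // xdeg m f.1 = 1 ∧ ydeg m f.1 = 1} + finrank K (siegelBox K m) = (∑ i : Fin n, m i) * (∑ i : Fin n, m i) := by
  have h := finrank_boxSiegelIdeal_inf_plane₂_eq K m 1 1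
  rw [boxSiegelIdeal_inf_plane₂_one_one, Nat.choose_one_right] at h
  omega

end Summit.Ventures.HSemireg.Wedge.HankelBoxSiegelIdeal
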